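import Mathlib
import Literature.Analysis.FluidPDE.VectorCalculus
import Literature.Analysis.FluidPDE.NSWave0
import Summits.NavierStokesRegularity.NavierStokesRegularity.Theses.PlaneEnergyCeiling
import Summits.NavierStokesRegularity.NavierStokesRegularity.Theorems.PlaneEnergyCeilingSlabEnergyIdentitySlab
import Summits.NavierStokesRegularity.NavierStokesRegularity.Theorems.PlaneEnergyCeilingSlabEnergyIdentityPointwise

/-!
# Support item `SlabEnergyIdentity` (stmt-NavierStokesRegularity-16859), route PlaneEnergyCeiling:
  THE SLAB ENERGY IDENTITY — proof

For any real `ν`, `a < b`, smooth rapidly decaying divergence-free `u : ℝ³ → ℝ³` and smooth rapidly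
decaying `p : ℝ³ → ℝ`, with `acc = νΔu − (u·∇)u − ∇p`, flux `F(c) = ∫_{x₂=c} (|u|²/2 + p) u₂ dA` and
`B(c) = ∫_{x₂=c} ⟪u, ∂₂u⟫ dA`:
`∫_{a<x₂<b} 2⟪u, acc⟫ = 2ν (B b − B a) − 2ν ∫_{a<x₂<b} |∇u|² − 2 (F b − F a)`.

Proof (folklore: the local energy equality of Caffarelli–Kohn–Nirenberg 1982 §2 /
Lemarié-Rieusset 2016 Ch. 13 for smooth fields, integrated over a slab): pointwise
`2⟪u, acc⟫ = 2ν Σⱼ ∂ⱼ⟪u, ∂ⱼu⟫ − 2ν Σⱼ ‖∂ⱼu‖² − 2 Σⱼ ∂ⱼ((|u|²/2 + p) uⱼ)` (`two_mul_inner_acc`, using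
`div u = 0`), all densities are continuous and `O((1 + |x|)⁻⁴)` by rapid decay (so integrable on
`ℝ³` and on every plane), and the divergence theorem on the slab (`sum_setIntegral_slab_fderiv`:
Fubini along the plane foliation, FTC in `x₂`, whole-plane integration by parts in `x₀, x₁`) turns
the two divergence sums into the boundary terms `2ν (B b − B a)` and `2 (F b − F a)`.

* `PlaneEnergyCeilingSlabEnergyIdentity.integrable_*` — integrability of the densities and their
  slices from `HasRapidSpatialDecay`;
* `planeEnergyCeiling_slabEnergyIdentity` — the route item, literally
  `Summit.NavierStokesRegularity.NavierStokesRegularity.Theses.PlaneEnergyCeiling.SlabEnergyIdentity`.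
-/

noncomputable section

-- Problem = summit for this single-conjunct summit: the duplicate namespace component is deliberate.
set_option linter.dupNamespace false

namespace Summit.NavierStokesRegularity.NavierStokesRegularity.Theorems

open MeasureTheory Set Filter Topology WithLp
open scoped RealInnerProductSpace
open Literature.Analysis.FluidPDE

namespace PlaneEnergyCeilingSlabEnergyIdentity

/-! ### Smoothness and integrability of the densities -/

variable {u : EuclideanSpace ℝ (Fin 3) → EuclideanSpace ℝ (Fin 3)} {p : EuclideanSpace ℝ (Fin 3) → ℝ}

/-- `⟪u, ∂ⱼu⟫` is `C¹` for `C²` fields. -/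
theorem contDiff_inner_fderiv (hu : ContDiff ℝ 2 u) (j : Fin 3) :
    ContDiff ℝ 1 fun z => ⟪u z, fderiv ℝ u z (EuclideanSpace.single j 1)⟫ :=
  (hu.of_le one_le_two).inner ℝ ((hu.fderiv_right (m := 1) le_rfl).clm_apply contDiff_const)

/-- `(‖u‖²/2 + p) uⱼ` is `C¹` for `C¹` fields. -/
theorem contDiff_bernoulli_mul (hu : ContDiff ℝ 1 u) (hp : ContDiff ℝ 1 p) (j : Fin 3) :
    ContDiff ℝ 1 fun z => (‖u z‖ ^ 2 / 2 + p z) * u z j :=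
  (((hu.norm_sq ℝ).div_const 2).add hp).mul (contDiff_euclidean.1 hu j)

/-- `⟪u, ∂ⱼu⟫` is integrable on `ℝ³`. -/
theorem integrable_inner_fderiv (hu : ContDiff ℝ 2 u) (hdu : HasRapidSpatialDecay u)
    (hdp : HasRapidSpatialDecay p) (j : Fin 3) :
    Integrable fun z => ⟪u z, fderiv ℝ u z (EuclideanSpace.single j 1)⟫ := by
  obtain ⟨C, hC, h0, h1, -, -, -⟩ := exists_decay_constant hdu hdp
  exact integrable_of_norm_le_weight (contDiff_inner_fderiv hu j).continuous fun x =>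
    norm_inner_fderiv_le hC (weight_pos x).le (weight_le_one x) (h0 x) (h1 x) j

/-- `⟪u, ∂ⱼu⟫` is integrable on every plane `{x₂ = c}`. -/
theorem integrable_inner_fderiv_slice (hu : ContDiff ℝ 2 u) (hdu : HasRapidSpatialDecay u)
    (hdp : HasRapidSpatialDecay p) (j : Fin 3) (c : ℝ) :
    Integrable fun y : EuclideanSpace ℝ (Fin 2) => ⟪u (toLp 2 ![y 0, y 1, c]),
      fderiv ℝ u (toLp 2 ![y 0, y 1, c]) (EuclideanSpace.single j 1)⟫ := by
  obtain ⟨C, hC, h0, h1, -, -, -⟩ := exists_decay_constant hdu hdp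
  exact integrable_slice_of_norm_le_weight
    (g := fun z => ⟪u z, fderiv ℝ u z (EuclideanSpace.single j 1)⟫)
    (contDiff_inner_fderiv hu j).continuous
    (fun x => norm_inner_fderiv_le hC (weight_pos x).le (weight_le_one x) (h0 x) (h1 x) j) c

/-- `∂ⱼ⟪u, ∂ⱼu⟫` is integrable on `ℝ³`. -/
theorem integrable_fderiv_inner_fderiv (hu : ContDiff ℝ 2 u) (hdu : HasRapidSpatialDecay u)
    (hdp : HasRapidSpatialDecay p) (j : Fin 3) :
    Integrable fun x => fderiv ℝ (fun z => ⟪u z, fderiv ℝ u z (EuclideanSpace.single j 1)⟫) x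
      (EuclideanSpace.single j 1) := by
  obtain ⟨C, hC, h0, h1, h2, -, -⟩ := exists_decay_constant hdu hdp
  refine integrable_of_norm_le_weight (C := 4 * C ^ 3)
    (((contDiff_inner_fderiv hu j).continuous_fderiv one_ne_zero).clm_apply continuous_const)
    fun x => ?_
  rw [fderiv_inner_fderiv_apply hu]
  exact norm_fderiv_inner_fderiv_le hC (weight_pos x).le (weight_le_one x) (h0 x) (h1 x) (h2 x) j

/-- The dissipation density `‖∂ⱼu‖²` is integrable on `ℝ³`. -/
theorem integrable_norm_sq_fderiv (hu : ContDiff ℝ 1 u) (hdu : HasRapidSpatialDecay u)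
    (hdp : HasRapidSpatialDecay p) (j : Fin 3) :
    Integrable fun x => ‖fderiv ℝ u x (EuclideanSpace.single j 1)‖ ^ 2 := by
  obtain ⟨C, hC, -, h1, -, -, -⟩ := exists_decay_constant hdu hdp
  exact integrable_of_norm_le_weight
    (((hu.continuous_fderiv one_ne_zero).clm_apply continuous_const).norm.pow 2) fun x =>
    norm_sq_fderiv_le hC (weight_pos x).le (weight_le_one x) (h1 x) j

/-- The Bernoulli flux density `(‖u‖²/2 + p) uⱼ` is integrable on `ℝ³`. -/
theorem integrable_bernoulli_mul (hu : ContDiff ℝ 1 u) (hp : ContDiff ℝ 1 p)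
    (hdu : HasRapidSpatialDecay u) (hdp : HasRapidSpatialDecay p) (j : Fin 3) :
    Integrable fun z => (‖u z‖ ^ 2 / 2 + p z) * u z j := by
  obtain ⟨C, hC, h0, -, -, k0, -⟩ := exists_decay_constant hdu hdp
  exact integrable_of_norm_le_weight (contDiff_bernoulli_mul hu hp j).continuous fun x =>
    norm_bernoulli_mul_le hC (weight_pos x).le (weight_le_one x) (h0 x) (k0 x) j

/-- The Bernoulli flux density is integrable on every plane `{x₂ = c}`. -/
theorem integrable_bernoulli_mul_slice (hu : ContDiff ℝ 1 u) (hp : ContDiff ℝ 1 p)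
    (hdu : HasRapidSpatialDecay u) (hdp : HasRapidSpatialDecay p) (j : Fin 3) (c : ℝ) :
    Integrable fun y : EuclideanSpace ℝ (Fin 2) => (‖u (toLp 2 ![y 0, y 1, c])‖ ^ 2 / 2 + p (toLp 2 ![y 0, y 1, c])) *
      u (toLp 2 ![y 0, y 1, c]) j := by
  obtain ⟨C, hC, h0, -, -, k0, -⟩ := exists_decay_constant hdu hdp
  exact integrable_slice_of_norm_le_weight (g := fun z => (‖u z‖ ^ 2 / 2 + p z) * u z j)
    (contDiff_bernoulli_mul hu hp j).continuous
    (fun x => norm_bernoulli_mul_le hC (weight_pos x).le (weight_le_one x) (h0 x) (k0 x) j) c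

/-- `∂ⱼ((‖u‖²/2 + p) uⱼ)` is integrable on `ℝ³`. -/
theorem integrable_fderiv_bernoulli_mul (hu : ContDiff ℝ 1 u) (hp : ContDiff ℝ 1 p)
    (hdu : HasRapidSpatialDecay u) (hdp : HasRapidSpatialDecay p) (j : Fin 3) :
    Integrable fun x => fderiv ℝ (fun z => (‖u z‖ ^ 2 / 2 + p z) * u z j) x
      (EuclideanSpace.single j 1) := by
  obtain ⟨C, hC, h0, h1, -, k0, k1⟩ := exists_decay_constant hdu hdp
  refine integrable_of_norm_le_weight (C := 4 * C ^ 3)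
    (((contDiff_bernoulli_mul hu hp j).continuous_fderiv one_ne_zero).clm_apply continuous_const)
    fun x => ?_
  rw [fderiv_bernoulli_mul_apply (hu.differentiable one_ne_zero) (hp.differentiable one_ne_zero)]
  exact norm_fderiv_bernoulli_mul_le hC (weight_le_one x) (h0 x) (h1 x) (k0 x) (k1 x) j

/-! ### The two divergence sums over the slab -/

/-- The viscous divergence sum over the slab is the boundary term:
`Σⱼ ∫_{S(a,b)} ∂ⱼ⟪u, ∂ⱼu⟫ = B b − B a`, `B c = ∫_y ⟪u, ∂₂u⟫(y₀,y₁,c)`. -/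
theorem sum_setIntegral_fderiv_inner_fderiv (hu : ContDiff ℝ 2 u) (hdu : HasRapidSpatialDecay u)
    (hdp : HasRapidSpatialDecay p) {a b : ℝ} (hab : a ≤ b) :
    ∑ j : Fin 3, ∫ x in {x : EuclideanSpace ℝ (Fin 3) | a < x 2 ∧ x 2 < b},
        fderiv ℝ (fun z => ⟪u z, fderiv ℝ u z (EuclideanSpace.single j 1)⟫) x
          (EuclideanSpace.single j 1) =
      (∫ y : EuclideanSpace ℝ (Fin 2), ⟪u (toLp 2 ![y 0, y 1, b]),
          fderiv ℝ u (toLp 2 ![y 0, y 1, b]) (EuclideanSpace.single 2 1)⟫) -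
        ∫ y : EuclideanSpace ℝ (Fin 2), ⟪u (toLp 2 ![y 0, y 1, a]),
          fderiv ℝ u (toLp 2 ![y 0, y 1, a]) (EuclideanSpace.single 2 1)⟫ :=
  sum_setIntegral_slab_fderiv
    (φ := fun j z => ⟪u z, fderiv ℝ u z (EuclideanSpace.single j 1)⟫)
    (fun j => contDiff_inner_fderiv hu j) (fun j => integrable_inner_fderiv hu hdu hdp j)
    (fun j => integrable_fderiv_inner_fderiv hu hdu hdp j) hab
    (integrable_inner_fderiv_slice hu hdu hdp 2 a) (integrable_inner_fderiv_slice hu hdu hdp 2 b)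

/-- The Bernoulli divergence sum over the slab is the flux difference:
`Σⱼ ∫_{S(a,b)} ∂ⱼ((‖u‖²/2 + p) uⱼ) = F b − F a`, `F c = ∫_y ((‖u‖²/2 + p) u₂)(y₀,y₁,c)`. -/
theorem sum_setIntegral_fderiv_bernoulli_mul (hu : ContDiff ℝ 1 u) (hp : ContDiff ℝ 1 p)
    (hdu : HasRapidSpatialDecay u) (hdp : HasRapidSpatialDecay p) {a b : ℝ} (hab : a ≤ b) :
    ∑ j : Fin 3, ∫ x in {x : EuclideanSpace ℝ (Fin 3) | a < x 2 ∧ x 2 < b},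
        fderiv ℝ (fun z => (‖u z‖ ^ 2 / 2 + p z) * u z j) x (EuclideanSpace.single j 1) =
      (∫ y : EuclideanSpace ℝ (Fin 2), (‖u (toLp 2 ![y 0, y 1, b])‖ ^ 2 / 2 + p (toLp 2 ![y 0, y 1, b])) *
          u (toLp 2 ![y 0, y 1, b]) 2) -
        ∫ y : EuclideanSpace ℝ (Fin 2), (‖u (toLp 2 ![y 0, y 1, a])‖ ^ 2 / 2 + p (toLp 2 ![y 0, y 1, a])) *
          u (toLp 2 ![y 0, y 1, a]) 2 :=
  sum_setIntegral_slab_fderiv (φ := fun j z => (‖u z‖ ^ 2 / 2 + p z) * u z j)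
    (fun j => contDiff_bernoulli_mul hu hp j) (fun j => integrable_bernoulli_mul hu hp hdu hdp j)
    (fun j => integrable_fderiv_bernoulli_mul hu hp hdu hdp j) hab
    (integrable_bernoulli_mul_slice hu hp hdu hdp 2 a) (integrable_bernoulli_mul_slice hu hp hdu hdp 2 b)

end PlaneEnergyCeilingSlabEnergyIdentity

open PlaneEnergyCeilingSlabEnergyIdentity in
/-- **The slab energy identity** (route `PlaneEnergyCeiling`, support item
stmt-NavierStokesRegularity-16859; folklore — the local energy equality of
Caffarelli–Kohn–Nirenberg 1982, §2 / Lemarié-Rieusset 2016, Ch. 13, for smooth fields, integrated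
over the slab `{a < x₂ < b}`): for any real `ν`, `a < b`, smooth rapidly decaying divergence-free
`u` and smooth rapidly decaying `p` on `ℝ³`, with `acc = νΔu − (u·∇)u − ∇p`,
`F(c) = ∫_{x₂=c} (|u|²/2 + p) u₂` and `B(c) = ∫_{x₂=c} ⟪u, ∂₂u⟫`,
`∫_{a<x₂<b} 2⟪u, acc⟫ = 2ν (B b − B a) − 2ν ∫_{a<x₂<b} Σⱼ ‖∂ⱼu‖² − 2 (F b − F a)`. -/
theorem planeEnergyCeiling_slabEnergyIdentity :
    Summit.NavierStokesRegularity.NavierStokesRegularity.Theses.PlaneEnergyCeiling.SlabEnergyIdentity := by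
  intro ν a b hab u p hu hp hdu hdp hdiv
  dsimp only
  have hu2 : ContDiff ℝ 2 u := hu.of_le (by norm_cast)
  have hu1 : ContDiff ℝ 1 u := hu.of_le (by exact_mod_cast le_top)
  have hp1 : ContDiff ℝ 1 p := hp.of_le (by exact_mod_cast le_top)
  -- the pointwise local energy identity
  have hpt := two_mul_inner_acc hu2 (hp1.differentiable one_ne_zero) hdiv ν
  -- integrability of the three densities on `ℝ³`
  have hA : Integrable fun x => ∑ j : Fin 3,
      fderiv ℝ (fun z => ⟪u z, fderiv ℝ u z (EuclideanSpace.single j 1)⟫) x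
        (EuclideanSpace.single j 1) :=
    integrable_finsetSum _ fun j _ => integrable_fderiv_inner_fderiv hu2 hdu hdp j
  have hD : Integrable fun x => ∑ j : Fin 3, ‖fderiv ℝ u x (EuclideanSpace.single j 1)‖ ^ 2 :=
    integrable_finsetSum _ fun j _ => integrable_norm_sq_fderiv hu1 hdu hdp j
  have hF : Integrable fun x => ∑ j : Fin 3,
      fderiv ℝ (fun z => (‖u z‖ ^ 2 / 2 + p z) * u z j) x (EuclideanSpace.single j 1) :=
    integrable_finsetSum _ fun j _ => integrable_fderiv_bernoulli_mul hu1 hp1 hdu hdp j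
  -- and on the slab
  have hI₁ : IntegrableOn (fun x => 2 * ν * ∑ j : Fin 3,
      fderiv ℝ (fun z => ⟪u z, fderiv ℝ u z (EuclideanSpace.single j 1)⟫) x
        (EuclideanSpace.single j 1) -
      2 * ν * ∑ j : Fin 3, ‖fderiv ℝ u x (EuclideanSpace.single j 1)‖ ^ 2)
      {x : EuclideanSpace ℝ (Fin 3) | a < x 2 ∧ x 2 < b} :=
    ((hA.const_mul _).sub' (hD.const_mul _)).integrableOn
  have hI₂ : IntegrableOn (fun x => 2 * ∑ j : Fin 3,
      fderiv ℝ (fun z => (‖u z‖ ^ 2 / 2 + p z) * u z j) x (EuclideanSpace.single j 1))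
      {x : EuclideanSpace ℝ (Fin 3) | a < x 2 ∧ x 2 < b} :=
    (hF.const_mul _).integrableOn
  have hI₃ : IntegrableOn (fun x => 2 * ν * ∑ j : Fin 3,
      fderiv ℝ (fun z => ⟪u z, fderiv ℝ u z (EuclideanSpace.single j 1)⟫) x
        (EuclideanSpace.single j 1)) {x : EuclideanSpace ℝ (Fin 3) | a < x 2 ∧ x 2 < b} :=
    (hA.const_mul _).integrableOn
  have hI₄ : IntegrableOn (fun x => 2 * ν * ∑ j : Fin 3, ‖fderiv ℝ u x (EuclideanSpace.single j 1)‖ ^ 2)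
      {x : EuclideanSpace ℝ (Fin 3) | a < x 2 ∧ x 2 < b} :=
    (hD.const_mul _).integrableOn
  rw [integral_congr_ae (Eventually.of_forall hpt), integral_sub hI₁ hI₂, integral_sub hI₃ hI₄,
    integral_const_mul, integral_const_mul, integral_const_mul,
    integral_finsetSum _ (fun j _ => (integrable_fderiv_inner_fderiv hu2 hdu hdp j).integrableOn),
    integral_finsetSum _ (fun j _ => (integrable_fderiv_bernoulli_mul hu1 hp1 hdu hdp j).integrableOn),
    sum_setIntegral_fderiv_inner_fderiv hu2 hdu hdp hab.le,
    sum_setIntegral_fderiv_bernoulli_mul hu1 hp1 hdu hdp hab.le]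

end Summit.NavierStokesRegularity.NavierStokesRegularity.Theorems

end
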